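import Summits.HodgeConjecture.CorCM.MultiFieldWeilThreefoldSurfaceBlocks
import Literature.AlgebraicGeometry.Pohlmann1968.SimpleCMAbelianVarietyHazamaCriterion
import Literature.AlgebraicGeometry.HodgeTheory.HodgeGroupProductCMFactorClasses
import HarnessLib

/-!
# MULTI-FIELD WEIL ENGINE — SEPARATED THREEFOLD BLOCKS: the threefold block itself splits along ANY grouping of the threefolds whose groups are pairwise
# SEPARATED (different Galois closures, no common imaginary quadratic subfield) — `Hg = ∏_c Hg(threefolds of group c ∪ their curves) × Hg(surfaces ∪ other curves)`,
# UNCONDITIONALLY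

Cell `pub-hodgecm2` (COR-CM), seat b30 gen 35 (2026-08-25); count-neutral own lane MULTI-FIELD WEIL ENGINE (stem `MultiFieldWeil*`), sequel of
`CorCM/MultiFieldWeilThreefoldSurfaceBlocks.lean` (one threefold block against the surface block).  Theorems only; no definition, no named fact, no `sorry`.  HONEST
FRAMING: everything here is UNCONDITIONAL — a structure theorem on Mumford–Tate groups (§1) and a transfer of instances of the Hodge conjecture (§2); `HC_CM` is NOT
proved and not asserted.

THE STATEMENT.  `A_i ⊨ (K_i; Φ_i)` (`i ∈ I`, finite) SIMPLE complex abelian varieties of CM type of dimension `≤ 3`; `b : I → C` ANY labelling (only its values on the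
sextic slots matter) such that two sextic slots `t, t′` with DIFFERENT labels are SEPARATED: the Galois closures of `K_t`, `K_{t′}` in `ℂ` differ AND no totally complex
quadratic subfield of `K_t` embeds in `K_{t′}` (seat b16's pair-kit hypothesis, `pairwise_simple_dim_le_three_of_normalClosure_ne`).  Send a slot `i` to the block
`some (b t)` when `K_i` embeds in the sextic member field `K_t` (well defined: a curve's field inside two threefold fields of different labels would be a common imaginary
quadratic subfield, a sextic field inside another one of degree `6` has the same closure), and to the block `none` otherwise (the simple surfaces and the remaining curves).
THEN (§1, **`cmFamilyRank_add_card_eq_separatedBlocks`**) the rank of the family is additive over this partition `κ : I → Option C` (onto its image):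
`Hg(∏_i A_i) = ∏_c Hg(∏_{κ i = some c} A_i) × Hg(∏_{κ j = none} A_j)` — NOTHING asked inside a block; and (§2, **`hodgeConjectureFor_prod_of_separatedBlocks`**) the Hodge
conjecture for the products of copies inside each block gives it for every product of copies of the whole family.  All cross pairs are in the tree BY NAME: threefold ∕
threefold of different labels and threefold ∕ simple surface = b16's pair kit; every other cross pair has a CM elliptic curve on one side whose field does not embed in the
other field (`pairwise_of_isEmpty`).  With `C = Unit` this is the previous file; with `b = id` every threefold is its own block («pairwise separated threefolds»).  NOT the
partial-conjugation gluing of `CorCM/MultiFieldWeilForeignBlocks.lean` (G10: closure-composita meeting in totally real fields): `K_t = k·F`, `K_{t′} = k′·F′` with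
`k′ = ℚ(√(−d·disc F))` (the «sister» of `k` for `F`) and `L_F ≠ L_{F′}` are separated although `k′ ⊂ L_t ∩ L_{t′}`.

[cite: MoonenZarhin1999LowDim, Thm. (0.2), §3 (3.1), Cor. (3.9)] [cite: Gordon1999HodgeAVSurvey, §3 Theorem (proof), 7.4–7.7] [cite: Shimura1998, §8.2 Prop. 26, §8.4 (2)]
[cite: Dodson1984, §1 and §5.1.2] [cite: MumfordAV1970, §19 Thm. 1 and p. 169]

## References
* [MoonenZarhin1999LowDim] B. Moonen, Yu. Zarhin, Math. Ann. 315 (1999) 711–733.  [Gordon1999HodgeAVSurvey] B. B. Gordon, *A survey of the Hodge conjecture for abelian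
  varieties*, §3, 7.4–7.7.  [Shimura1998] G. Shimura, *Abelian varieties with complex multiplication and modular functions*, §8.2, §8.4.  [Dodson1984] B. Dodson, *The
  structure of Galois groups of CM-fields*, Trans. AMS 283 (1984).  [MumfordAV1970] D. Mumford, *Abelian Varieties*, §19.
-/

noncomputable section

open CategoryTheory CategoryTheory.Limits NumberField IntermediateField

namespace Summit.HodgeConjecture.CorCM.MultiFieldWeil

open Literature.AlgebraicGeometry Literature.AlgebraicGeometry.Motives Literature.AlgebraicGeometry.HodgeTheory
open Literature.AlgebraicGeometry.ComplexMultiplication (IsCMTypeRealisation)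
open Literature.AlgebraicTopology.SingularHomology
open Literature.NumberTheory.ComplexMultiplication
open Literature.AlgebraicGeometry.Pohlmann1968

open scoped Classical

variable {I : Type} {K : I → Type} [∀ i, Field (K i)] [∀ i, NumberField (K i)] [∀ i, IsCMField (K i)]
  {Φ : ∀ i, CMType (K i)} {A : I → AbelianVariety ℂ} {ι : ∀ i, 𝓞 (K i) →+* End (A i)} {θ : ∀ i, K i →+* Module.End ℂ (complexBetti (A i).X 1)}
  {C : Type}

/-! ## §0 Quadratic subfields from pairs of embeddings; degrees -/

section Prelim

omit [∀ i, IsCMField (K i)] in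
/-- The CM field of a realisation of dimension `≤ 3` has degree `2`, `4` or `6`. [cite: Shimura1998, §5.2] -/
private theorem finrank_eq_or_of_dim_le_three₃₅s (hA : ∀ i, IsCMTypeRealisation (Φ i) (A i) (ι i) (θ i)) {i : I} (h3 : (A i).dim ≤ 3) :
    Module.finrank ℚ (K i) = 2 ∨ Module.finrank ℚ (K i) = 4 ∨ Module.finrank ℚ (K i) = 6 := by
  have h := finrank_eq_two_mul_dim_of_isCMTypeRealisation (hA i)
  have hpos : 0 < Module.finrank ℚ (K i) := Module.finrank_pos
  interval_cases hd : (A i).dim <;> omega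

omit [∀ i, IsCMField (K i)] in
/-- An embedding of number fields `K_i ↪ K_t` makes `[K_i : ℚ]` divide `[K_t : ℚ]`. [cite: Shimura1998, §8.1] -/
private theorem finrank_dvd_of_ringHom₃₅s {i t : I} (g : K i →+* K t) : Module.finrank ℚ (K i) ∣ Module.finrank ℚ (K t) := by
  have h1 : Module.finrank ℚ ↥g.toRatAlgHom.fieldRange = Module.finrank ℚ (K i) :=
    ((AlgEquiv.ofInjectiveField g.toRatAlgHom).toLinearEquiv.finrank_eq).symm
  rw [← h1, ← IntermediateField.finrank_top' (F := ℚ) (E := K t)]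
  exact IntermediateField.finrank_dvd_of_le_right le_top

omit [∀ i, IsCMField (K i)] in
/-- **Two embeddings `k ↪ K_t`, `k ↪ K_{t′}` of a totally complex quadratic field exhibit a totally complex quadratic subfield of `K_t` embedding in `K_{t′}`** (the
image of `k`). [cite: Shimura1998, §8.4] -/
theorem exists_quadratic_subfield_of_ringHom_ringHom {k : Type} [Field k] [NumberField k] [IsTotallyComplex k] (h2 : Module.finrank ℚ k = 2) {t t' : I}
    (e : k →+* K t) (e' : k →+* K t') : ∃ F : IntermediateField ℚ (K t), Module.finrank ℚ F = 2 ∧ IsTotallyComplex F ∧ Nonempty (F →+* K t') := by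
  let f : k →ₐ[ℚ] K t := e.toRatAlgHom
  have h1 : Module.finrank ℚ ↥f.fieldRange = Module.finrank ℚ k := ((AlgEquiv.ofInjectiveField f).toLinearEquiv.finrank_eq).symm
  let ε : ↥f.fieldRange ≃+* k := (AlgEquiv.ofInjectiveField f).symm.toRingEquiv
  refine ⟨f.fieldRange, h1.trans h2, ?_, ⟨e'.comp ε.toRingHom⟩⟩
  letI : Algebra k ↥f.fieldRange := ε.symm.toRingHom.toAlgebra
  exact isTotallyComplex_of_algebra k _

omit [∀ i, IsCMField (K i)] in
/-- **An embedding between two number fields of the same degree identifies their Galois closures in `ℂ`** (it is an isomorphism, and the closure is the compositum of the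
images of all embeddings into `ℂ`). [cite: Lang2002, V §1 Prop. 1.2 and VI §1 Thm. 1.1] -/
theorem normalClosure_eq_of_ringHom_of_finrank_eq {i t : I} (g : K i →+* K t) (h : Module.finrank ℚ (K i) = Module.finrank ℚ (K t)) :
    normalClosure ℚ (K i) ℂ = normalClosure ℚ (K t) ℂ := by
  -- `g` is an isomorphism (injective between spaces of the same finite dimension)
  have hinj : Function.Injective g.toRatAlgHom.toLinearMap := g.injective
  have hsurj : Function.Surjective g.toRatAlgHom.toLinearMap := (LinearMap.injective_iff_surjective_of_finrank_eq_finrank h).1 hinj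
  let ε : K i ≃ₐ[ℚ] K t := AlgEquiv.ofBijective g.toRatAlgHom ⟨hinj, hsurj⟩
  apply le_antisymm
  · refine normalClosure_le_iff.2 fun s => ?_
    have hs : s.fieldRange ≤ (s.comp (ε.symm : K t →ₐ[ℚ] K i)).fieldRange := by
      rintro x ⟨y, rfl⟩
      exact ⟨ε y, by simp⟩
    exact hs.trans (AlgHom.fieldRange_le_normalClosure _)
  · refine normalClosure_le_iff.2 fun s => ?_
    have hs : s.fieldRange ≤ (s.comp (ε : K i →ₐ[ℚ] K t)).fieldRange := by
      rintro x ⟨y, rfl⟩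
      exact ⟨ε.symm y, by simp⟩
    exact hs.trans (AlgHom.fieldRange_le_normalClosure _)

end Prelim

/-! ## §1 Separated threefold blocks split (Mumford–Tate ranks) -/

section Rank

/-- **A slot's field embeds in sextic member fields of ONE label only** (under separation of differently labelled sextic slots): a quadratic field inside `K_t` and `K_{t′}`
is a common imaginary quadratic subfield; a sextic field inside both has the closure of both. [cite: Shimura1998, §8.4 (2)] [cite: Lang2002, VI §1 Thm. 1.1] -/
theorem label_eq_of_ringHom_ringHom (hA : ∀ i, IsCMTypeRealisation (Φ i) (A i) (ι i) (θ i)) (h3 : ∀ i, (A i).dim ≤ 3) (b : I → C)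
    (hsep : ∀ t t', Module.finrank ℚ (K t) = 6 → Module.finrank ℚ (K t') = 6 → b t ≠ b t' →
      normalClosure ℚ (K t) ℂ ≠ normalClosure ℚ (K t') ℂ ∧ ¬ ∃ F : IntermediateField ℚ (K t), Module.finrank ℚ F = 2 ∧ IsTotallyComplex F ∧ Nonempty (F →+* K t'))
    {i t t' : I} (ht : Module.finrank ℚ (K t) = 6) (ht' : Module.finrank ℚ (K t') = 6) (e : K i →+* K t) (e' : K i →+* K t') : b t = b t' := by
  by_contra hne
  obtain ⟨hL, hno⟩ := hsep t t' ht ht' hne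
  rcases finrank_eq_or_of_dim_le_three₃₅s hA (h3 i) with h2 | h4 | h6
  · exact hno (exists_quadratic_subfield_of_ringHom_ringHom h2 e e')
  · have h := finrank_dvd_of_ringHom₃₅s e
    rw [h4, ht] at h
    omega
  · exact hL ((normalClosure_eq_of_ringHom_of_finrank_eq e (h6.trans ht.symm)).symm.trans
      (normalClosure_eq_of_ringHom_of_finrank_eq e' (h6.trans ht'.symm)))

/-- **THE CROSS-BLOCK SLOT CRITERION between two threefold blocks of different labels.**  `K_i ↪ K_t`, `K_j ↪ K_{t′}` with `[K_t:ℚ] = [K_{t′}:ℚ] = 6`, `b t ≠ b t′`: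
the `Aut(ℂ)`-modules `U(Φ_i)`, `U(Φ_j)` share no constituent (threefold ∕ threefold: b16's pair kit; a curve on either side: its field does not embed in the other field,
else it would embed in sextic fields of both labels). [cite: MoonenZarhin1999LowDim, Thm. (0.2), (3.1), Cor. (3.9)] [cite: Gordon1999HodgeAVSurvey, §3 Theorem (proof), 7.5] -/
theorem pairwise_separatedBlocks (hA : ∀ i, IsCMTypeRealisation (Φ i) (A i) (ι i) (θ i)) (hS : ∀ i, (A i).IsSimple) (h3 : ∀ i, (A i).dim ≤ 3) (b : I → C)
    (hsep : ∀ t t', Module.finrank ℚ (K t) = 6 → Module.finrank ℚ (K t') = 6 → b t ≠ b t' →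
      normalClosure ℚ (K t) ℂ ≠ normalClosure ℚ (K t') ℂ ∧ ¬ ∃ F : IntermediateField ℚ (K t), Module.finrank ℚ F = 2 ∧ IsTotallyComplex F ∧ Nonempty (F →+* K t'))
    {i j t t' : I} (ht : Module.finrank ℚ (K t) = 6) (ht' : Module.finrank ℚ (K t') = 6) (e : K i →+* K t) (e' : K j →+* K t') (hb : b t ≠ b t') :
    (∀ P : Submodule ℚ ((K i →+* ℂ) → ℚ), P ≤ antiSpan (ℂ ≃+* ℂ) (Φ i).1 →
      (∀ g : ℂ ≃+* ℂ, ∀ f ∈ P, (fun x => f (g • x)) ∈ P) →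
      ∀ T : ((K i →+* ℂ) → ℚ) →ₗ[ℚ] ((K j →+* ℂ) → ℚ),
        (∀ g : ℂ ≃+* ℂ, ∀ f ∈ P, T (fun x => f (g • x)) = fun y => T f (g • y)) →
        (∀ f ∈ P, T f ∈ antiSpan (ℂ ≃+* ℂ) (Φ j).1) → (∀ f ∈ P, T f = 0 → f = 0) → P = ⊥) ∧
    (∀ P : Submodule ℚ ((K j →+* ℂ) → ℚ), P ≤ antiSpan (ℂ ≃+* ℂ) (Φ j).1 →
      (∀ g : ℂ ≃+* ℂ, ∀ f ∈ P, (fun x => f (g • x)) ∈ P) →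
      ∀ T : ((K j →+* ℂ) → ℚ) →ₗ[ℚ] ((K i →+* ℂ) → ℚ),
        (∀ g : ℂ ≃+* ℂ, ∀ f ∈ P, T (fun x => f (g • x)) = fun y => T f (g • y)) →
        (∀ f ∈ P, T f ∈ antiSpan (ℂ ≃+* ℂ) (Φ i).1) → (∀ f ∈ P, T f = 0 → f = 0) → P = ⊥) := by
  -- no slot embeds in both `K_t` and `K_{t'}`
  have hij : IsEmpty (K i →+* K j) := ⟨fun g => hb (label_eq_of_ringHom_ringHom hA h3 b hsep ht ht' e (e'.comp g))⟩
  have hji : IsEmpty (K j →+* K i) := ⟨fun g => hb (label_eq_of_ringHom_ringHom hA h3 b hsep ht ht' (e.comp g) e')⟩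
  have hi4 : Module.finrank ℚ (K i) ≠ 4 := fun h4 => by
    have h := finrank_dvd_of_ringHom₃₅s e
    rw [h4, ht] at h
    omega
  have hj4 : Module.finrank ℚ (K j) ≠ 4 := fun h4 => by
    have h := finrank_dvd_of_ringHom₃₅s e'
    rw [h4, ht'] at h
    omega
  rcases finrank_eq_or_of_dim_le_three₃₅s hA (h3 i) with hi2 | hi4' | hi6
  · exact pairwise_of_isEmpty Φ hi2 hij
  · exact absurd hi4' hi4
  · rcases finrank_eq_or_of_dim_le_three₃₅s hA (h3 j) with hj2 | hj4' | hj6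
    · have h := pairwise_of_isEmpty Φ hj2 hji
      exact ⟨h.2, h.1⟩
    · exact absurd hj4' hj4
    · -- two threefolds of different labels: the closures of `K_i ≅ K_t` and `K_j ≅ K_{t'}` differ, and no imaginary quadratic subfield passes
      have hbi : b i ≠ b j := fun h =>
        hb ((label_eq_of_ringHom_ringHom hA h3 b hsep hi6 ht (RingHom.id _) e).symm.trans
          (h.trans (label_eq_of_ringHom_ringHom hA h3 b hsep hj6 ht' (RingHom.id _) e')))
      obtain ⟨hL, hno⟩ := hsep i j hi6 hj6 hbi
      obtain ⟨-, hno'⟩ := hsep j i hj6 hi6 hbi.symm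
      exact pairwise_simple_dim_le_three_of_normalClosure_ne hA hS h3 hL hno hno'

variable [Fintype I]

/-- **SEPARATED THREEFOLD BLOCKS SPLIT (ranks).**  `A_i ⊨ (K_i; Φ_i)` (`i ∈ I` finite) SIMPLE of dimension `≤ 3`; `b : I → C` a labelling separating differently labelled
sextic slots (different Galois closures, no common imaginary quadratic subfield); `κ : I → Option C` a block map with `κ i = some (b t)` whenever `K_i ↪ K_t` with
`[K_t : ℚ] = 6` and `κ i = none` when `K_i` embeds in no sextic member field; `D` the set of blocks met (`κ` onto `D`).  Then
`rank(Σ) + |D| = Σ_{d ∈ D} rank(Σ|_{κ = d}) + 1`: `Hg(∏_i A_i) = ∏_d Hg(∏_{κ i = d} A_i)` — UNCONDITIONALLY, nothing asked inside a block.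
[cite: MoonenZarhin1999LowDim, Thm. (0.2), §3 (3.1), Cor. (3.9)] [cite: Gordon1999HodgeAVSurvey, §3 Theorem (proof), 7.5] -/
theorem cmFamilyRank_add_card_eq_separatedBlocks [Nonempty I] (hA : ∀ i, IsCMTypeRealisation (Φ i) (A i) (ι i) (θ i)) (hS : ∀ i, (A i).IsSimple)
    (h3 : ∀ i, (A i).dim ≤ 3) (b : I → C)
    (hsep : ∀ t t', Module.finrank ℚ (K t) = 6 → Module.finrank ℚ (K t') = 6 → b t ≠ b t' →
      normalClosure ℚ (K t) ℂ ≠ normalClosure ℚ (K t') ℂ ∧ ¬ ∃ F : IntermediateField ℚ (K t), Module.finrank ℚ F = 2 ∧ IsTotallyComplex F ∧ Nonempty (F →+* K t'))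
    {D : Type} [Fintype D] (κ : I → D) (hκ : Function.Surjective κ) (val : D → Option C) (hval : Function.Injective val)
    (hsome : ∀ i t, Module.finrank ℚ (K t) = 6 → Nonempty (K i →+* K t) → val (κ i) = some (b t))
    (hnone : ∀ i, (¬ ∃ t, Module.finrank ℚ (K t) = 6 ∧ Nonempty (K i →+* K t)) → val (κ i) = none) :
    CMAlgebra.cmFamilyRank Φ + Fintype.card D = (∑ d, CMAlgebra.cmFamilyRank fun i : {i : I // κ i = d} => Φ i.1) + 1 := by
  refine CMAlgebra.cmFamilyRank_add_card_eq_of_pairwise_slots_fiber Φ κ hκ fun i j hij => ?_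
  have hv : val (κ i) ≠ val (κ j) := fun h => hij (hval h)
  by_cases hi : ∃ t, Module.finrank ℚ (K t) = 6 ∧ Nonempty (K i →+* K t) <;> by_cases hj : ∃ t, Module.finrank ℚ (K t) = 6 ∧ Nonempty (K j →+* K t)
  · obtain ⟨t, ht, ⟨e⟩⟩ := hi
    obtain ⟨t', ht', ⟨e'⟩⟩ := hj
    have hb : b t ≠ b t' := fun h => hv (by rw [hsome i t ht ⟨e⟩, hsome j t' ht' ⟨e'⟩, h])
    exact (pairwise_separatedBlocks hA hS h3 b hsep ht ht' e e' hb).1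
  · exact (pairwise_threefoldBlock_surfaceBlock hA hS h3 hi hj).1
  · exact (pairwise_threefoldBlock_surfaceBlock hA hS h3 hj hi).2
  · exact absurd ((hnone i hi).trans (hnone j hj).symm) hv

end Rank

/-! ## §2 The Hodge conjecture glues the separated blocks -/

section Glue

variable [Fintype I]

/-- **SEPARATED THREEFOLD BLOCKS GLUE (Hodge conjecture).**  Same setting (`κ : I ↠ D`, `val : D ↪ Option C` reading the blocks: `some (b t)` for the slots through the
sextic field `K_t`, `none` for the slots through no sextic member field).  IF the Hodge conjecture holds for every product of copies of the members of each single block,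
THEN it holds for EVERY product of copies `⨁_j A_{π j}` of the whole family — UNCONDITIONALLY (§1 and seat b16's block gluing).
[cite: MoonenZarhin1999LowDim, Thm. (0.2), §3 (3.1), Cor. (3.9)] [cite: Gordon1999HodgeAVSurvey, §3 Theorem (proof), 7.5–7.7] -/
theorem hodgeConjectureFor_prod_of_separatedBlocks (hA : ∀ i, IsCMTypeRealisation (Φ i) (A i) (ι i) (θ i)) (hS : ∀ i, (A i).IsSimple) (h3 : ∀ i, (A i).dim ≤ 3)
    (b : I → C)
    (hsep : ∀ t t', Module.finrank ℚ (K t) = 6 → Module.finrank ℚ (K t') = 6 → b t ≠ b t' →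
      normalClosure ℚ (K t) ℂ ≠ normalClosure ℚ (K t') ℂ ∧ ¬ ∃ F : IntermediateField ℚ (K t), Module.finrank ℚ F = 2 ∧ IsTotallyComplex F ∧ Nonempty (F →+* K t'))
    {D : Type} [Fintype D] (κ : I → D) (hκ : Function.Surjective κ) (val : D → Option C) (hval : Function.Injective val)
    (hsome : ∀ i t, Module.finrank ℚ (K t) = 6 → Nonempty (K i →+* K t) → val (κ i) = some (b t))
    (hnone : ∀ i, (¬ ∃ t, Module.finrank ℚ (K t) = 6 ∧ Nonempty (K i →+* K t)) → val (κ i) = none)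
    (hHC : ∀ (d : D) (M : ℕ) (ρ : Fin M → I), (∀ l, κ (ρ l) = d) → HodgeConjectureFor (⨁ fun l => A (ρ l)).dim (⨁ fun l => A (ρ l)).X)
    {N : ℕ} (π : Fin N → I) : HodgeConjectureFor (⨁ fun j => A (π j)).dim (⨁ fun j => A (π j)).X := by
  cases N with
  | zero => exact hodgeConjectureFor_of_isDivisorGenerated _ (isDivisorGenerated_of_dim_eq_zero _ (dim_biproduct_fin_zero _))
  | succ N =>
    haveI : Nonempty I := ⟨π 0⟩
    refine hodgeConjectureFor_biproduct_of_cmFamilyRank_fiber_add_card_eq κ hκ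
      (cmFamilyRank_add_card_eq_separatedBlocks hA hS h3 b hsep κ hκ val hval hsome hnone) hA (fun d J _ _ π' => ?_) π
    -- re-index the `J`-indexed product of members of the block `d` by `Fin |J|`
    let ε : Fin (Fintype.card J) ≃ J := (Fintype.equivFin J).symm
    have hdom : Domination.AVDominatedBy (⨁ fun j => A (π' j).1) (⨁ fun l => A (π' (ε l)).1) :=
      Domination.AVDominatedBy.of_iso (biproduct.reindex ε fun j => A (π' j).1).symm (Domination.AVDominatedBy.refl _)
    exact Domination.hodgeConjectureFor_of_avDominatedBy (hHC d _ (fun l => (π' (ε l)).1) fun l => (π' (ε l)).2) hdom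

/-- **Dominated form** of `hodgeConjectureFor_prod_of_separatedBlocks`. [cite: MoonenZarhin1999LowDim, §3 (3.1)] [cite: MumfordAV1970, §19 Thm. 1 and p. 169] -/
theorem hodgeConjectureFor_of_avDominatedBy_prod_of_separatedBlocks (hA : ∀ i, IsCMTypeRealisation (Φ i) (A i) (ι i) (θ i)) (hS : ∀ i, (A i).IsSimple)
    (h3 : ∀ i, (A i).dim ≤ 3) (b : I → C)
    (hsep : ∀ t t', Module.finrank ℚ (K t) = 6 → Module.finrank ℚ (K t') = 6 → b t ≠ b t' →
      normalClosure ℚ (K t) ℂ ≠ normalClosure ℚ (K t') ℂ ∧ ¬ ∃ F : IntermediateField ℚ (K t), Module.finrank ℚ F = 2 ∧ IsTotallyComplex F ∧ Nonempty (F →+* K t'))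
    {D : Type} [Fintype D] (κ : I → D) (hκ : Function.Surjective κ) (val : D → Option C) (hval : Function.Injective val)
    (hsome : ∀ i t, Module.finrank ℚ (K t) = 6 → Nonempty (K i →+* K t) → val (κ i) = some (b t))
    (hnone : ∀ i, (¬ ∃ t, Module.finrank ℚ (K t) = 6 ∧ Nonempty (K i →+* K t)) → val (κ i) = none)
    (hHC : ∀ (d : D) (M : ℕ) (ρ : Fin M → I), (∀ l, κ (ρ l) = d) → HodgeConjectureFor (⨁ fun l => A (ρ l)).dim (⨁ fun l => A (ρ l)).X)
    {N : ℕ} (π : Fin N → I) {X : AbelianVariety ℂ} (hX : Domination.AVDominatedBy X (⨁ fun j => A (π j))) : HodgeConjectureFor X.dim X.X :=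
  Domination.hodgeConjectureFor_of_avDominatedBy (hodgeConjectureFor_prod_of_separatedBlocks hA hS h3 b hsep κ hκ val hval hsome hnone hHC π) hX

end Glue

/-! ## §3 The canonical block map: reading the blocks off the labels -/

section Labels

variable [Fintype I]

/-- **GLUING ALONG THE LABELS (the form consumers use).**  `A_i ⊨ (K_i; Φ_i)` (`i ∈ I` finite) SIMPLE of dimension `≤ 3`; `b : I → C` a labelling separating differently
labelled sextic slots.  IF for every label `c` the Hodge conjecture holds for every product of copies of members whose field embeds in a sextic member field of label `c`
(the threefolds labelled `c` and the curves through their fields), AND it holds for every product of copies of members whose field embeds in no sextic member field (the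
simple surfaces and the remaining curves), THEN it holds for every product of copies `⨁_j A_{π j}` of the whole family — UNCONDITIONALLY.  (The block map
`i ↦ some (b t)` ∕ `none` is assembled here once and for all: `label_eq_of_ringHom_ringHom` makes the label of a slot well defined.)
[cite: MoonenZarhin1999LowDim, Thm. (0.2), §3 (3.1), Cor. (3.9)] [cite: Gordon1999HodgeAVSurvey, §3 Theorem (proof), 7.5–7.7] -/
theorem hodgeConjectureFor_prod_of_separatedLabels (hA : ∀ i, IsCMTypeRealisation (Φ i) (A i) (ι i) (θ i)) (hS : ∀ i, (A i).IsSimple) (h3 : ∀ i, (A i).dim ≤ 3)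
    (b : I → C)
    (hsep : ∀ t t', Module.finrank ℚ (K t) = 6 → Module.finrank ℚ (K t') = 6 → b t ≠ b t' →
      normalClosure ℚ (K t) ℂ ≠ normalClosure ℚ (K t') ℂ ∧ ¬ ∃ F : IntermediateField ℚ (K t), Module.finrank ℚ F = 2 ∧ IsTotallyComplex F ∧ Nonempty (F →+* K t'))
    (hT : ∀ (c : C) (M : ℕ) (ρ : Fin M → I), (∀ l, ∃ t, Module.finrank ℚ (K t) = 6 ∧ Nonempty (K (ρ l) →+* K t) ∧ b t = c) →
      HodgeConjectureFor (⨁ fun l => A (ρ l)).dim (⨁ fun l => A (ρ l)).X)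
    (hN : ∀ (M : ℕ) (ρ : Fin M → I), (∀ l, ¬ ∃ t, Module.finrank ℚ (K t) = 6 ∧ Nonempty (K (ρ l) →+* K t)) →
      HodgeConjectureFor (⨁ fun l => A (ρ l)).dim (⨁ fun l => A (ρ l)).X)
    {N : ℕ} (π : Fin N → I) : HodgeConjectureFor (⨁ fun j => A (π j)).dim (⨁ fun j => A (π j)).X := by
  -- the block of a slot, read off the labels
  let blk : I → Option C := fun i => if h : ∃ t, Module.finrank ℚ (K t) = 6 ∧ Nonempty (K i →+* K t) then some (b (Classical.choose h)) else none
  have hblk_some : ∀ i t, Module.finrank ℚ (K t) = 6 → Nonempty (K i →+* K t) → blk i = some (b t) := by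
    intro i t ht hne
    have h : ∃ t, Module.finrank ℚ (K t) = 6 ∧ Nonempty (K i →+* K t) := ⟨t, ht, hne⟩
    have hc := Classical.choose_spec h
    obtain ⟨e₀⟩ := hc.2
    obtain ⟨e⟩ := hne
    simp only [blk, dif_pos h, Option.some.injEq]
    exact label_eq_of_ringHom_ringHom hA h3 b hsep hc.1 ht e₀ e
  have hblk_none : ∀ i, (¬ ∃ t, Module.finrank ℚ (K t) = 6 ∧ Nonempty (K i →+* K t)) → blk i = none := fun i h => by
    simp only [blk, dif_neg h]
  -- the blocks met, as a finite type
  let D : Type := {o : Option C // ∃ i, blk i = o}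
  let κ : I → D := fun i => ⟨blk i, i, rfl⟩
  have hκ : Function.Surjective κ := by
    rintro ⟨o, i, hi⟩
    exact ⟨i, Subtype.ext hi⟩
  haveI : Fintype D := Fintype.ofSurjective κ hκ
  refine hodgeConjectureFor_prod_of_separatedBlocks hA hS h3 b hsep κ hκ (fun d => d.1) Subtype.val_injective (fun i t ht hne => hblk_some i t ht hne)
    (fun i hi => hblk_none i hi) (fun d M ρ hρ => ?_) π
  rcases hd : d.1 with _ | c
  · -- the block `none`: no member's field embeds in a sextic member field
    refine hN M ρ fun l h => ?_
    obtain ⟨t, ht, hne⟩ := h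
    have h1 : blk (ρ l) = none := by rw [← hd, ← hρ l]
    rw [hblk_some (ρ l) t ht hne] at h1
    exact Option.some_ne_none _ h1
  · -- the block of the label `c`
    refine hT c M ρ fun l => ?_
    have h1 : blk (ρ l) = some c := by rw [← hd, ← hρ l]
    by_cases h : ∃ t, Module.finrank ℚ (K t) = 6 ∧ Nonempty (K (ρ l) →+* K t)
    · obtain ⟨t, ht, hne⟩ := h
      refine ⟨t, ht, hne, ?_⟩
      rw [hblk_some (ρ l) t ht hne, Option.some.injEq] at h1
      exact h1
    · rw [hblk_none (ρ l) h] at h1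
      exact absurd h1 (Option.some_ne_none c).symm

/-- **Dominated form** of `hodgeConjectureFor_prod_of_separatedLabels`. [cite: MoonenZarhin1999LowDim, §3 (3.1)] [cite: MumfordAV1970, §19 Thm. 1 and p. 169] -/
theorem hodgeConjectureFor_of_avDominatedBy_prod_of_separatedLabels (hA : ∀ i, IsCMTypeRealisation (Φ i) (A i) (ι i) (θ i)) (hS : ∀ i, (A i).IsSimple)
    (h3 : ∀ i, (A i).dim ≤ 3) (b : I → C)
    (hsep : ∀ t t', Module.finrank ℚ (K t) = 6 → Module.finrank ℚ (K t') = 6 → b t ≠ b t' →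
      normalClosure ℚ (K t) ℂ ≠ normalClosure ℚ (K t') ℂ ∧ ¬ ∃ F : IntermediateField ℚ (K t), Module.finrank ℚ F = 2 ∧ IsTotallyComplex F ∧ Nonempty (F →+* K t'))
    (hT : ∀ (c : C) (M : ℕ) (ρ : Fin M → I), (∀ l, ∃ t, Module.finrank ℚ (K t) = 6 ∧ Nonempty (K (ρ l) →+* K t) ∧ b t = c) →
      HodgeConjectureFor (⨁ fun l => A (ρ l)).dim (⨁ fun l => A (ρ l)).X)
    (hN : ∀ (M : ℕ) (ρ : Fin M → I), (∀ l, ¬ ∃ t, Module.finrank ℚ (K t) = 6 ∧ Nonempty (K (ρ l) →+* K t)) →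
      HodgeConjectureFor (⨁ fun l => A (ρ l)).dim (⨁ fun l => A (ρ l)).X)
    {N : ℕ} (π : Fin N → I) {X : AbelianVariety ℂ} (hX : Domination.AVDominatedBy X (⨁ fun j => A (π j))) : HodgeConjectureFor X.dim X.X :=
  Domination.hodgeConjectureFor_of_avDominatedBy (hodgeConjectureFor_prod_of_separatedLabels hA hS h3 b hsep hT hN π) hX

end Labels

end Summit.HodgeConjecture.CorCM.MultiFieldWeil

end
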